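import Literature.Analysis.Hypoelliptic.EllipticParametrix
import HarnessLib

/-!
# The parametrix of an elliptic operator to any order

Analysis/Hypoelliptic support file, sequel of `EllipticParametrix.lean` (the crude parametrix
`twOp q = χ + r` with `r` an amplitude of order `-1`, for the transposed operator
`ᵗL = ∑_{w ∈ S} ᵗX_w (b_w ·)` elliptic of order `k` on the support of the cutoff `χ`). Here the
classical iteration (Taylor 1981, Ch. III §1; Folland 1995, Ch. 8 §D: solve away the remainder with
the correction `q_c = c · q₁`, `q₁ = χ₁ (1 - θ)/σ̃`) is carried out inside the amplitude calculus of
`Amplitude.lean`, giving a parametrix with a remainder of arbitrarily negative order: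

* `IsAmp.mul` — the product of amplitudes of orders `m`, `m'` is an amplitude of order `m + m'`
  (Leibniz); `IsAmp.mul_bumpθ` — an amplitude cut off to `‖ξ‖ ≤ 2` in the frequency has every
  order;
* `twT_add`, `twW_add`, `twOp_add`, `twOp_const_mul`, `twOp_sub` — the twisted calculus is
  linear on amplitudes; `twOp_eventuallyEq_zero`, `tsupport_twOp_subset` — and local in `x`;
* `twSymb_mul_parQ` — `σ̃ · q₁ = χ₁ (1 - θ)`;
* `exists_parametrix_correction` — for an amplitude `c` of order `m` supported (in `x`) in a set
  on which `χ₁ = 1` there is `q_c` of order `m - k` with `twOp q_c = c + r_c`, `r_c` of order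
  `m - 1`, both supported where `c` is;
* `exists_parametrix_order` — **for every `N` there are amplitudes `q` of order `-k` and `r` of
  order `-(N + 1)` with `twOp q = χ + r`**, `q` supported in `tsupport χ₁` and `r` in
  `tsupport χ` (so that, by `IsAmp.opC_ampOp`, `ᵗL (Op(q) F) = χ · 𝓕⁻¹F + Op(r) F`).

Everything here is proved; there are no definitions and no named facts.

## References

* M. E. Taylor, *Pseudodifferential Operators*, Princeton Univ. Press (1981), Ch. III §1
  (elliptic parametrices; folklore).
* G. B. Folland, *Introduction to Partial Differential Equations*, 2nd ed. (1995), Ch. 8 §D,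
  Thm. (8.44)–(8.45) (folklore).
-/

noncomputable section

open MeasureTheory Set Filter Function TopologicalSpace Real Metric
open scoped Topology InnerProductSpace BigOperators ContDiff ComplexConjugate ENNReal

namespace Literature.Analysis.Hypoelliptic

open Literature.Analysis.Distribution

variable {V : Type*} [NormedAddCommGroup V] [InnerProductSpace ℝ V]

/-! ### Products of amplitudes -/

namespace IsAmp

variable {a c : V → V → ℂ} {m m' : ℝ}

/-- **The product of two amplitudes** of orders `m` and `m'` is an amplitude of order `m + m'`
(Leibniz' rule for the `x`-derivatives and `⟨ξ⟩^m ⟨ξ⟩^{m'} = ⟨ξ⟩^{m+m'}`). Taylor 1981, Ch. II §1.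
[folklore] -/
theorem mul (ha : IsAmp a m) (hc : IsAmp c m') : IsAmp (fun x ξ => a x ξ * c x ξ) (m + m') where
  smooth := ha.smooth.mul hc.smooth
  supp := by
    obtain ⟨K, hK, h⟩ := hc.supp
    exact ⟨K, hK, fun ξ =>
      (tsupport_mul_subset_right (f := fun x => a x ξ) (g := fun x => c x ξ)).trans (h ξ)⟩
  bound N := by
    choose C hC0 hC using ha.bound
    choose D hD0 hD using hc.bound
    refine ⟨∑ i ∈ Finset.range (N + 1), (N.choose i : ℝ) * C i * D (N - i),
      Finset.sum_nonneg fun i _ => by have h0 := hC0 i; have h0' := hD0 (N - i); positivity,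
      fun x ξ => ?_⟩
    have hL := norm_iteratedFDeriv_mul_le (ha.slice ξ) (hc.slice ξ) x (n := N) (mod_cast le_top)
    refine hL.trans ?_
    rw [Finset.sum_mul]
    refine Finset.sum_le_sum fun i _ => ?_
    have h1 := hC i x ξ
    have h2 := hD (N - i) x ξ
    have h0 := hC0 i; have h0' := hD0 (N - i); have hb1 := bw_nonneg m ξ; have hb2 := bw_nonneg m' ξ
    calc (N.choose i : ℝ) * ‖iteratedFDeriv ℝ i (fun y => a y ξ) x‖ *
          ‖iteratedFDeriv ℝ (N - i) (fun y => c y ξ) x‖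
        ≤ (N.choose i : ℝ) * (C i * bw m ξ) * (D (N - i) * bw m' ξ) :=
          mul_le_mul (mul_le_mul_of_nonneg_left h1 (Nat.cast_nonneg _)) h2 (norm_nonneg _)
            (by positivity)
      _ = (N.choose i : ℝ) * C i * D (N - i) * bw (m + m') ξ := by rw [bw_add]; ring

omit [InnerProductSpace ℝ V] in
/-- On the ball `‖ξ‖ ≤ 2` all the weights `⟨ξ⟩^m` are comparable:
`⟨ξ⟩^m ≤ 5^{|m|/2} 5^{|m'|/2} ⟨ξ⟩^{m'}`. [folklore] -/
theorem bw_le_bw_of_norm_le_two (m m' : ℝ) {ξ : V} (hξ : ‖ξ‖ ≤ 2) :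
    bw m ξ ≤ (5 : ℝ) ^ (|m| / 2) * (5 : ℝ) ^ (|m'| / 2) * bw m' ξ := by
  have h5 : 1 + ‖ξ‖ ^ 2 ≤ 5 := by nlinarith [norm_nonneg ξ]
  have hup : ∀ s : ℝ, bw |s| ξ ≤ (5 : ℝ) ^ (|s| / 2) := fun s => by
    rw [bw_def]
    exact Real.rpow_le_rpow (one_add_norm_sq_pos ξ).le h5 (by positivity)
  have hm : bw m ξ ≤ (5 : ℝ) ^ (|m| / 2) := (bw_mono (le_abs_self m) ξ).trans (hup m)
  have hlow : 1 ≤ (5 : ℝ) ^ (|m'| / 2) * bw m' ξ := by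
    have h2 : bw (-|m'|) ξ ≤ bw m' ξ := bw_mono (neg_abs_le m') ξ
    have h4 : 0 < bw |m'| ξ := bw_pos _ _
    have h3 : bw |m'| ξ * bw (-|m'|) ξ = 1 := bw_mul_bw_neg _ _
    calc (1 : ℝ) = bw |m'| ξ * bw (-|m'|) ξ := h3.symm
      _ ≤ (5 : ℝ) ^ (|m'| / 2) * bw m' ξ :=
          mul_le_mul (hup m') h2 (bw_nonneg _ _) (by positivity)
  calc bw m ξ ≤ (5 : ℝ) ^ (|m| / 2) * 1 := by rw [mul_one]; exact hm
    _ ≤ (5 : ℝ) ^ (|m| / 2) * ((5 : ℝ) ^ (|m'| / 2) * bw m' ξ) :=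
        mul_le_mul_of_nonneg_left hlow (by positivity)
    _ = _ := by ring

/-- **An amplitude cut off to `‖ξ‖ ≤ 2` has every order**: `θ(ξ) a(x, ξ)` is an amplitude of
order `m'` for all `m'` (`θ = bumpθ`, `= 0` for `‖ξ‖ ≥ 2`). [folklore] -/
theorem mul_bumpθ [FiniteDimensional ℝ V] (ha : IsAmp a m) (m' : ℝ) :
    IsAmp (fun x ξ => ((bumpθ V ξ : ℝ) : ℂ) * a x ξ) m' where
  smooth := (Complex.ofRealCLM.contDiff.comp ((bumpθ V).contDiff.comp contDiff_snd)).mul ha.smooth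
  supp := by
    obtain ⟨K, hK, h⟩ := ha.supp
    exact ⟨K, hK, fun ξ =>
      (tsupport_mul_subset_right (f := fun _ : V => ((bumpθ V ξ : ℝ) : ℂ)) (g := fun x => a x ξ)).trans
        (h ξ)⟩
  bound N := by
    obtain ⟨C, hC0, hC⟩ := ha.bound N
    refine ⟨C * ((5 : ℝ) ^ (|m| / 2) * (5 : ℝ) ^ (|m'| / 2)), by positivity, fun x ξ => ?_⟩
    have e : (fun y => ((bumpθ V ξ : ℝ) : ℂ) * a y ξ) = ((bumpθ V ξ : ℝ) : ℂ) • fun y => a y ξ := rfl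
    rw [e, iteratedFDeriv_const_smul_apply ((ha.slice ξ).contDiffAt.of_le (mod_cast le_top)),
      norm_smul]
    by_cases hξ : 2 ≤ ‖ξ‖
    · rw [bumpθ_eq_zero hξ]
      simp only [Complex.ofReal_zero, norm_zero, zero_mul]
      exact mul_nonneg (by positivity) (bw_nonneg _ _)
    · rw [not_le] at hξ
      have hθ : ‖((bumpθ V ξ : ℝ) : ℂ)‖ ≤ 1 := by
        rw [Complex.norm_real, Real.norm_of_nonneg ((bumpθ V).nonneg' ξ)]; exact (bumpθ V).le_one
      calc ‖((bumpθ V ξ : ℝ) : ℂ)‖ * ‖iteratedFDeriv ℝ N (fun y => a y ξ) x‖ ≤ 1 * (C * bw m ξ) :=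
            mul_le_mul hθ (hC x ξ) (norm_nonneg _) zero_le_one
        _ ≤ C * ((5 : ℝ) ^ (|m| / 2) * (5 : ℝ) ^ (|m'| / 2) * bw m' ξ) := by
            rw [one_mul]
            exact mul_le_mul_of_nonneg_left (bw_le_bw_of_norm_le_two m m' hξ.le) hC0
        _ = C * ((5 : ℝ) ^ (|m| / 2) * (5 : ℝ) ^ (|m'| / 2)) * bw m' ξ := by ring

end IsAmp

/-! ### Linearity and locality of the twisted calculus -/

section Twist

variable [FiniteDimensional ℝ V] {ι : Type*} {Y : ι → V → V} {S : Finset (List ι)}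
  {b : List ι → V → ℝ} {k : ℕ} {a c : V → V → ℂ} {m m' : ℝ}

omit [FiniteDimensional ℝ V] in
/-- `twT` is additive on amplitudes. [folklore] -/
theorem twT_add (ha : IsAmp a m) (hc : IsAmp c m') (Z : V → V) :
    twT Z (fun x ξ => a x ξ + c x ξ) = fun x ξ => twT Z a x ξ + twT Z c x ξ := by
  ext x ξ
  have hd : fderiv ℝ (fun y => a y ξ + c y ξ) x =
      fderiv ℝ (fun y => a y ξ) x + fderiv ℝ (fun y => c y ξ) x :=
    fderiv_add ((ha.slice ξ).differentiable (by simp) x) ((hc.slice ξ).differentiable (by simp) x)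
  simp only [twT, twD, hd, _root_.add_apply]
  ring

omit [FiniteDimensional ℝ V] in
/-- `twT` commutes with constant factors. [folklore] -/
theorem twT_const_mul (ha : IsAmp a m) (κ : ℂ) (Z : V → V) :
    twT Z (fun x ξ => κ * a x ξ) = fun x ξ => κ * twT Z a x ξ := by
  ext x ξ
  have hd : fderiv ℝ (fun y => κ * a y ξ) x = κ • fderiv ℝ (fun y => a y ξ) x :=
    fderiv_const_mul ((ha.slice ξ).differentiable (by simp) x) κ
  simp only [twT, twD, hd, _root_.smul_apply, smul_eq_mul]
  ring

/-- `twW` is additive on amplitudes. [folklore] -/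
theorem twW_add (hY : ∀ i, ContDiff ℝ ∞ (Y i)) :
    ∀ (w : List ι) {a c : V → V → ℂ} {m m' : ℝ}, IsAmp a m → IsAmp c m' →
      twW Y w (fun x ξ => a x ξ + c x ξ) = fun x ξ => twW Y w a x ξ + twW Y w c x ξ
  | [], _, _, _, _, _, _ => rfl
  | i :: w, a, c, m, m', ha, hc => by
    rw [twW_cons, twW_cons, twW_cons, twT_add ha hc]
    exact twW_add hY w (isAmp_twT ha (hY i)) (isAmp_twT hc (hY i))

/-- `twW` commutes with constant factors. [folklore] -/
theorem twW_const_mul (hY : ∀ i, ContDiff ℝ ∞ (Y i)) (κ : ℂ) :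
    ∀ (w : List ι) {a : V → V → ℂ} {m : ℝ}, IsAmp a m →
      twW Y w (fun x ξ => κ * a x ξ) = fun x ξ => κ * twW Y w a x ξ
  | [], _, _, _ => rfl
  | i :: w, a, m, ha => by
    rw [twW_cons, twW_cons, twT_const_mul ha κ]
    exact twW_const_mul hY κ w (isAmp_twT ha (hY i))

/-- **`twOp` is additive on amplitudes.** [folklore] -/
theorem twOp_add (hY : ∀ i, ContDiff ℝ ∞ (Y i)) (hb : ∀ w, ContDiff ℝ ∞ (b w))
    (ha : IsAmp a m) (hc : IsAmp c m') :
    twOp Y S b (fun x ξ => a x ξ + c x ξ) = fun x ξ => twOp Y S b a x ξ + twOp Y S b c x ξ := by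
  ext x ξ
  simp only [twOp]
  rw [← Finset.sum_add_distrib]
  refine Finset.sum_congr rfl fun w _ => ?_
  have e : (fun y η => (b w y : ℂ) * (a y η + c y η)) =
      fun y η => (b w y : ℂ) * a y η + (b w y : ℂ) * c y η := by
    ext y η; ring
  rw [e, twW_add hY w (ha.smul_fun_real (hb w)) (hc.smul_fun_real (hb w))]

/-- **`twOp` commutes with constant factors.** [folklore] -/
theorem twOp_const_mul (hY : ∀ i, ContDiff ℝ ∞ (Y i)) (hb : ∀ w, ContDiff ℝ ∞ (b w))
    (ha : IsAmp a m) (κ : ℂ) :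
    twOp Y S b (fun x ξ => κ * a x ξ) = fun x ξ => κ * twOp Y S b a x ξ := by
  ext x ξ
  simp only [twOp]
  rw [Finset.mul_sum]
  refine Finset.sum_congr rfl fun w _ => ?_
  have e : (fun y η => (b w y : ℂ) * (κ * a y η)) = fun y η => κ * ((b w y : ℂ) * a y η) := by
    ext y η; ring
  rw [e, twW_const_mul hY κ w (ha.smul_fun_real (hb w))]

/-- **`twOp` of a difference.** [folklore] -/
theorem twOp_sub (hY : ∀ i, ContDiff ℝ ∞ (Y i)) (hb : ∀ w, ContDiff ℝ ∞ (b w))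
    (ha : IsAmp a m) (hc : IsAmp c m') :
    twOp Y S b (fun x ξ => a x ξ - c x ξ) = fun x ξ => twOp Y S b a x ξ - twOp Y S b c x ξ := by
  have e : (fun x ξ => a x ξ - c x ξ) = fun x ξ => a x ξ + (-1 : ℂ) * c x ξ := by ext x ξ; ring
  rw [e, twOp_add hY hb ha (hc.const_mul (-1)), twOp_const_mul hY hb hc (-1)]
  ext x ξ; ring

omit [FiniteDimensional ℝ V] in
/-- Locality of `twT`: if `a(·, ξ)` vanishes near `x` then so does `twT Z a (·) ξ`. [folklore] -/
theorem twT_eventuallyEq_zero (Z : V → V) {a : V → V → ℂ} {x ξ : V}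
    (h : (fun y => a y ξ) =ᶠ[𝓝 x] 0) : (fun y => twT Z a y ξ) =ᶠ[𝓝 x] 0 := by
  have hd : (fderiv ℝ fun y => a y ξ) =ᶠ[𝓝 x] fderiv ℝ (0 : V → ℂ) := h.fderiv
  filter_upwards [h, hd] with y hy hdy
  have hy' : a y ξ = 0 := by simpa using hy
  show twT Z a y ξ = 0
  simp only [twT, twD, hy', hdy, mul_zero, sub_zero]
  simp

omit [FiniteDimensional ℝ V] in
/-- Locality of `twW`. [folklore] -/
theorem twW_eventuallyEq_zero (Y : ι → V → V) :
    ∀ (w : List ι) {a : V → V → ℂ} {x ξ : V},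
      ((fun y => a y ξ) =ᶠ[𝓝 x] 0) → ((fun y => twW Y w a y ξ) =ᶠ[𝓝 x] 0)
  | [], _, _, _, h => h
  | i :: w, a, x, ξ, h => by
    simp only [twW_cons]
    exact twW_eventuallyEq_zero Y w (twT_eventuallyEq_zero (Y i) h)

omit [FiniteDimensional ℝ V] in
/-- **Locality of `twOp` in `x`**: if `a(·, ξ)` vanishes near `x` then so does
`twOp a (·) ξ`. [folklore] -/
theorem twOp_eventuallyEq_zero (Y : ι → V → V) (S : Finset (List ι)) (b : List ι → V → ℝ)
    {a : V → V → ℂ} {x ξ : V} (h : (fun y => a y ξ) =ᶠ[𝓝 x] 0) :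
    (fun y => twOp Y S b a y ξ) =ᶠ[𝓝 x] 0 := by
  have hw : ∀ w ∈ S, (fun y => twW Y w (fun y η => (b w y : ℂ) * a y η) y ξ) =ᶠ[𝓝 x] 0 :=
    fun w _ => twW_eventuallyEq_zero Y w (by
      filter_upwards [h] with y hy
      have hy' : a y ξ = 0 := by simpa using hy
      show (b w y : ℂ) * a y ξ = 0
      rw [hy', mul_zero])
  filter_upwards [(S.eventually_all).2 hw] with y hy
  show twOp Y S b a y ξ = 0
  simp only [twOp]
  exact Finset.sum_eq_zero fun w hw' => by simpa using hy w hw'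

omit [FiniteDimensional ℝ V] in
/-- The `x`-support of `twOp a (·) ξ` lies in that of `a(·, ξ)`. [folklore] -/
theorem tsupport_twOp_subset (Y : ι → V → V) (S : Finset (List ι)) (b : List ι → V → ℝ)
    (a : V → V → ℂ) (ξ : V) :
    tsupport (fun x => twOp Y S b a x ξ) ⊆ tsupport (fun x => a x ξ) := by
  intro x hx
  by_contra hxa
  exact (notMem_tsupport_iff_eventuallyEq.2
    (twOp_eventuallyEq_zero Y S b (notMem_tsupport_iff_eventuallyEq.1 hxa))) hx

end Twist

/-! ### The correction step and the parametrix to any order -/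

section Order

variable [FiniteDimensional ℝ V] {ι : Type*} {Y : ι → V → V} {S : Finset (List ι)}
  {b : List ι → V → ℝ} {k : ℕ}

/-- **`σ̃ · q₁ = χ₁ (1 - θ)`** for the parametrix amplitude `q₁ = parQ χ₁` of an operator elliptic
on `tsupport χ₁`. [folklore] -/
theorem twSymb_mul_parQ {χ : V → ℝ}
    (hell : ∀ x ∈ tsupport χ, ∀ ξ : V, ξ ≠ 0 → twSymb Y S b k x ξ ≠ 0) (x ξ : V) :
    twSymb Y S b k x ξ * parQ Y S b k χ x ξ = (χ x : ℂ) * (((1 : ℝ) - bumpθ V ξ : ℝ) : ℂ) := by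
  by_cases h : twSymb Y S b k x ξ = 0
  · rw [h, zero_mul]
    by_cases hχx : χ x = 0
    · simp [hχx]
    · have hx : x ∈ tsupport χ := subset_tsupport _ (mem_support.2 hχx)
      by_cases hξ : ξ = 0
      · rw [hξ, bumpθ_eq_one (by simp)]; simp
      · exact absurd h (hell x hx ξ hξ)
  · simp only [parQ]; field_simp

/-- **The correction step of the parametrix iteration.** Let `ᵗL` be elliptic of order `k` on
`tsupport χ₁` and `χ₁ = 1` on the set `K₀`. For an amplitude `c` of order `m` whose `x`-slices are
supported in `K₀`, the amplitude `q_c = c · q₁` (`q₁ = χ₁ (1 - θ)/σ̃`) has order `m - k` and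
`twOp q_c = c + r_c` with `r_c` of order `m - 1`; the slices of `q_c` and `r_c` are again supported
in `K₀`. (Indeed `twOp q_c = σ̃ q_c + O(m - 1) = c (1 - θ) + O(m - 1)`, and `θ c` has every order.)
Taylor 1981, Ch. III §1. [folklore] -/
theorem exists_parametrix_correction [Nontrivial V] (hY : ∀ i, ContDiff ℝ ∞ (Y i))
    (hb : ∀ w, ContDiff ℝ ∞ (b w)) (hS : ∀ w ∈ S, w.length ≤ k)
    {χ₁ : V → ℝ} (hχ₁ : ContDiff ℝ ∞ χ₁) (hχ₁c : HasCompactSupport χ₁)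
    (hell : ∀ x ∈ tsupport χ₁, ∀ ξ : V, ξ ≠ 0 → twSymb Y S b k x ξ ≠ 0)
    {K₀ : Set V} (hK₀ : ∀ x ∈ K₀, χ₁ x = 1)
    {c : V → V → ℂ} {m : ℝ} (hc : IsAmp c m) (hcK : ∀ ξ, tsupport (fun x => c x ξ) ⊆ K₀) :
    ∃ q r : V → V → ℂ, IsAmp q (m - k) ∧ IsAmp r (m - 1) ∧
      (∀ ξ, tsupport (fun x => q x ξ) ⊆ K₀) ∧ (∀ ξ, tsupport (fun x => r x ξ) ⊆ K₀) ∧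
      twOp Y S b q = fun x ξ => c x ξ + r x ξ := by
  set q : V → V → ℂ := fun x ξ => c x ξ * parQ Y S b k χ₁ x ξ with hq
  have hqA : IsAmp q (m - k) := by
    have h := hc.mul (isAmp_parQ hY hb hχ₁ hχ₁c hell)
    rwa [← sub_eq_add_neg] at h
  have hqK : ∀ ξ, tsupport (fun x => q x ξ) ⊆ K₀ := fun ξ =>
    (tsupport_mul_subset_left (f := fun x => c x ξ) (g := fun x => parQ Y S b k χ₁ x ξ)).trans (hcK ξ)
  obtain ⟨r₁, hr₁, hr₁e⟩ := twOp_principal hY hb hS hqA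
  have e1 : m - k + k - 1 = m - 1 := by ring
  rw [e1] at hr₁
  -- `σ̃ q = c - θ c`
  have hσq : ∀ x ξ, twSymb Y S b k x ξ * q x ξ = c x ξ - ((bumpθ V ξ : ℝ) : ℂ) * c x ξ := by
    intro x ξ
    by_cases hcx : c x ξ = 0
    · simp [hq, hcx]
    · have hx : x ∈ K₀ := hcK ξ (subset_tsupport _ (mem_support.2 hcx))
      calc twSymb Y S b k x ξ * q x ξ = c x ξ * (twSymb Y S b k x ξ * parQ Y S b k χ₁ x ξ) := by
            simp only [hq]; ring
        _ = c x ξ - ((bumpθ V ξ : ℝ) : ℂ) * c x ξ := by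
            rw [twSymb_mul_parQ hell x ξ, hK₀ x hx]; push_cast; ring
  refine ⟨q, fun x ξ => r₁ x ξ - ((bumpθ V ξ : ℝ) : ℂ) * c x ξ, hqA,
    hr₁.sub (hc.mul_bumpθ (m - 1)), hqK, fun ξ => ?_, ?_⟩
  · -- support of the remainder: outside `K₀` all of `c`, `q`, `twOp q` vanish locally
    intro x hx
    by_contra hxK
    have hc0 : (fun y => c y ξ) =ᶠ[𝓝 x] 0 :=
      notMem_tsupport_iff_eventuallyEq.1 fun h' => hxK (hcK ξ h')
    have hq0 : (fun y => q y ξ) =ᶠ[𝓝 x] 0 :=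
      notMem_tsupport_iff_eventuallyEq.1 fun h' => hxK (hqK ξ h')
    have ht0 := twOp_eventuallyEq_zero Y S b hq0
    have hev : (fun y => r₁ y ξ - ((bumpθ V ξ : ℝ) : ℂ) * c y ξ) =ᶠ[𝓝 x] 0 := by
      filter_upwards [hc0, hq0, ht0] with y hyc hyq hyt
      have hyc' : c y ξ = 0 := by simpa using hyc
      have hyq' : q y ξ = 0 := by simpa using hyq
      have hyt' : twOp Y S b q y ξ = 0 := by simpa using hyt
      have h1 : twOp Y S b q y ξ = twSymb Y S b k y ξ * q y ξ + r₁ y ξ :=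
        congrFun (congrFun hr₁e y) ξ
      -- `twOp q y ξ = σ̃ q + r₁`
      have h2 : r₁ y ξ = twOp Y S b q y ξ - twSymb Y S b k y ξ * q y ξ := by rw [h1]; ring
      show r₁ y ξ - ((bumpθ V ξ : ℝ) : ℂ) * c y ξ = 0
      rw [h2, hyt', hyq', hyc']; ring
    exact (notMem_tsupport_iff_eventuallyEq.2 hev) hx
  · rw [hr₁e]
    ext x ξ
    simp only
    rw [hσq]
    ring

/-- **The parametrix of an elliptic operator to any order.** Let the words of `S` have length
`≤ k`, let `χ`, `χ₁` be smooth compactly supported cutoffs with `χ₁ = 1` on `tsupport χ`, and let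
`ᵗL = ∑_{w ∈ S} ᵗX_w (b_w ·)` be elliptic of order `k` on `tsupport χ₁` (`σ̃(x, ξ) ≠ 0` for
`x ∈ tsupport χ₁`, `ξ ≠ 0`). Then for every `N` there are amplitudes `q` of order `-k`, with slices
supported in `tsupport χ₁`, and `r` of order `-(N + 1)`, with slices supported in `tsupport χ`,
such that `twOp q = χ + r`; consequently `ᵗL (Op(q) F) = χ · 𝓕⁻¹ F + Op(r) F` for nice `F`
(`IsAmp.opC_ampOp`). Induction on `N`: the case `N = 0` is `exists_parametrix`, and the remainder is
solved away by `exists_parametrix_correction`. Taylor 1981, Ch. III §1; Folland 1995, Thm. (8.44).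
[folklore] -/
theorem exists_parametrix_order [Nontrivial V] (hY : ∀ i, ContDiff ℝ ∞ (Y i))
    (hb : ∀ w, ContDiff ℝ ∞ (b w)) (hS : ∀ w ∈ S, w.length ≤ k)
    {χ χ₁ : V → ℝ} (hχ : ContDiff ℝ ∞ χ) (hχc : HasCompactSupport χ)
    (hχ₁ : ContDiff ℝ ∞ χ₁) (hχ₁c : HasCompactSupport χ₁) (hχχ₁ : ∀ x ∈ tsupport χ, χ₁ x = 1)
    (hell : ∀ x ∈ tsupport χ₁, ∀ ξ : V, ξ ≠ 0 → twSymb Y S b k x ξ ≠ 0) (N : ℕ) :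
    ∃ q r : V → V → ℂ, IsAmp q (-k) ∧ IsAmp r (-(N + 1 : ℝ)) ∧
      (∀ ξ, tsupport (fun x => q x ξ) ⊆ tsupport χ₁) ∧
      (∀ ξ, tsupport (fun x => r x ξ) ⊆ tsupport χ) ∧
      twOp Y S b q = fun x ξ => (χ x : ℂ) + r x ξ := by
  have hsub : tsupport χ ⊆ tsupport χ₁ := fun x hx =>
    subset_tsupport _ (mem_support.2 (by rw [hχχ₁ x hx]; exact one_ne_zero))
  have hellχ : ∀ x ∈ tsupport χ, ∀ ξ : V, ξ ≠ 0 → twSymb Y S b k x ξ ≠ 0 :=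
    fun x hx => hell x (hsub hx)
  induction N with
  | zero =>
    obtain ⟨q, r, hq, hr, hqs, hqr⟩ := exists_parametrix hY hb hS hχ hχc hellχ
    refine ⟨q, r, hq, by simpa using hr, fun ξ => (hqs ξ).trans hsub, fun ξ => ?_, hqr⟩
    intro x hx
    by_contra hxχ
    have h1 : (fun y => q y ξ) =ᶠ[𝓝 x] 0 :=
      notMem_tsupport_iff_eventuallyEq.1 fun h => hxχ (hqs ξ h)
    have h2 : (fun y : V => χ y) =ᶠ[𝓝 x] 0 := notMem_tsupport_iff_eventuallyEq.1 hxχ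
    have h3 := twOp_eventuallyEq_zero Y S b h1
    have hev : (fun y => r y ξ) =ᶠ[𝓝 x] 0 := by
      filter_upwards [h2, h3] with y hy2 hy3
      have hy2' : χ y = 0 := by simpa using hy2
      have hy3' : twOp Y S b q y ξ = 0 := by simpa using hy3
      have h4 : twOp Y S b q y ξ = (χ y : ℂ) + r y ξ := congrFun (congrFun hqr y) ξ
      have h5 : r y ξ = twOp Y S b q y ξ - (χ y : ℂ) := by rw [h4]; ring
      show r y ξ = 0
      rw [h5, hy3', hy2']; simp
    exact (notMem_tsupport_iff_eventuallyEq.2 hev) hx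
  | succ N ih =>
    obtain ⟨q, r, hq, hr, hqs, hrs, hqr⟩ := ih
    obtain ⟨q', r', hq', hr', hq's, hr's, hq'r'⟩ :=
      exists_parametrix_correction hY hb hS hχ₁ hχ₁c hell (K₀ := tsupport χ) hχχ₁ hr hrs
    have hN : (0 : ℝ) ≤ N + 1 := by positivity
    refine ⟨fun x ξ => q x ξ - q' x ξ, fun x ξ => -r' x ξ, hq.sub (hq'.mono (by linarith)), ?_,
      fun ξ => ?_, fun ξ => ?_, ?_⟩
    · have e : -(N + 1 : ℝ) - 1 = -((N + 1 : ℕ) + 1 : ℝ) := by push_cast; ring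
      rw [e] at hr'
      exact hr'.neg
    · intro x hx
      by_contra hx1
      have h1 : (fun y => q y ξ) =ᶠ[𝓝 x] 0 :=
        notMem_tsupport_iff_eventuallyEq.1 fun h => hx1 (hqs ξ h)
      have h2 : (fun y => q' y ξ) =ᶠ[𝓝 x] 0 :=
        notMem_tsupport_iff_eventuallyEq.1 fun h => hx1 (hsub (hq's ξ h))
      have hev : (fun y => q y ξ - q' y ξ) =ᶠ[𝓝 x] 0 := by
        filter_upwards [h1, h2] with y hy1 hy2
        have hy1' : q y ξ = 0 := by simpa using hy1
        have hy2' : q' y ξ = 0 := by simpa using hy2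
        show q y ξ - q' y ξ = 0
        rw [hy1', hy2', sub_zero]
      exact (notMem_tsupport_iff_eventuallyEq.2 hev) hx
    · intro x hx
      by_contra hx1
      have h1 : (fun y => r' y ξ) =ᶠ[𝓝 x] 0 :=
        notMem_tsupport_iff_eventuallyEq.1 fun h => hx1 (hr's ξ h)
      have hev : (fun y => -r' y ξ) =ᶠ[𝓝 x] 0 := by
        filter_upwards [h1] with y hy1
        have hy1' : r' y ξ = 0 := by simpa using hy1
        show -r' y ξ = 0
        rw [hy1', neg_zero]
      exact (notMem_tsupport_iff_eventuallyEq.2 hev) hx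
    · rw [twOp_sub hY hb hq hq', hqr, hq'r']
      ext x ξ
      simp only
      ring

end Order

end Literature.Analysis.Hypoelliptic
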